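import Summits.HodgeConjecture.HodgeConjecture.Theorems.Ring2AbelianAllAndreSporadicClassesGoodFibres
import Summits.HodgeConjecture.HodgeConjecture.Theorems.Ring2AbelianAllAndreSporadicClassesNodes
import Summits.HodgeConjecture.HodgeConjecture.Theorems.Ring2AbelianAllAndreWeilSixfoldsMiddleDegree
import HarnessLib

/-!
# Ring 2 · sub-cell AbelianAll (ALL ABELIAN VARIETIES), André axis, part XXXI-e — SPORADIC ALGEBRAIC CLASSES, THE W₆ ROW: a DENSITY
# REDUCTION for the Weil sixfolds — `WeilSixfolds ⟸ (W_E)₃ ∧ [on every compact pencil of abelian sixfolds with an `E`-power fibre, the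
# invariant Hodge classes of degree 6 are algebraic on UNCOUNTABLY many members]` (granted Verdier; NO `HC_CM`), and the same with
# "the members satisfy the Hodge conjecture in degree 6 (resp. `HodgeConjectureFor 6`)" at uncountably many points

HONEST FRAMING (page 1, verbatim): **research route, not a corollary; conditional on HC_CM plus one named
minimal statement.** Cell line: research route conditional on HC_CM; not a corollary; Q11.4-sentence-2 already
refuted in dim ≥ 3. Nothing in this file proves a case of the Hodge conjecture for an abelian variety: `(W_E)₃`
(`CMPowerAnchoredCompactWeilPencilsAt 3`) is an OPEN habitat node and the uncountability clause is a HYPOTHESIS; the item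
`WeilSixfolds` (stmt-HodgeConjecture-2524) is NOT closed; `HC_CM` does NOT occur (the anchor fibres are powers of a CM elliptic
curve, where the Hodge conjecture is Tate's theorem — part XXVIII-e); `hGT` = Verdier's generic local triviality is a NAMED-FACT
BINDER; `B_min` of record (N104) untouched; NO node is born (0 `def`); nothing is claimed minimal.

## Content

Part XXVIII-e proved `WeilSixfolds ⟸ (W_E)₃ ∧ [(L)_t(3) at every E-power point of every compact pencil of abelian sixfolds]`.
Parts XXXI-b/d give `(L)_t(3)` at EVERY point of a pencil whose members over an UNCOUNTABLE set of points have their invariant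
Hodge classes of degree 6 algebraic (resp. satisfy `HC` in degree 6). Composing:
* **`weilSixfolds_of_cmPowerWeilPencilsAt_of_not_countable_good_of_verdier`** — W₆ ⟸ (W_E)₃ ∧ "uncountably many 3-good members on
  each `E`-power-pointed compact pencil of abelian sixfolds";
* `weilSixfolds_of_cmPowerWeilPencilsAt_of_not_countable_hodge_of_verdier` — the same with `HC` in degree 6 at uncountably many members;
* `weilSixfolds_of_cmPowerWeilPencilsAt_of_not_countable_hodgeConjectureFor_of_verdier` — with `HodgeConjectureFor 6` there;
* the NON-SPLIT twins.
READING: granted the habitat, the Hodge conjecture for ALL Weil-type abelian sixfolds follows from the algebraicity of the (invariant)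
Weil classes on a NON-MEAGRE set of members — uncountably many per pencil — of the `E`-power-pointed pencils: a density reduction,
with no `HC_CM`. PRECISELY (REFEREE-AB F-ab-131 (a)): the hypothesis of every row quantifies over EVERY compact pencil of abelian
sixfolds with an `E`-power fibre (this is what part XXVIII-e's `hL` needs), Weil-type or NOT — not only over the pencils the habitat
`(W_E)₃` supplies; so the `_hodge_` / `_hodgeConjectureFor_` rows ask `HC` in degree 6 at uncountably many members of every
`E`-power-pointed sixfold pencil, and "thick set of Weil sixfolds ⟹ all" under-describes them. Only the `_good_` row is immune: it
asks algebraicity of the INVARIANT Hodge classes of degree 6 only, which on a Weil-free pencil (e.g. Zariski-dense `Sp₁₂`-monodromy)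
are multiples of `θ³` — an explanation, not typed here. With that proviso the rows match the Weil seats' paper-level reading «HC at
the very general fibre ⟺ `W_K(P_vg)` algebraic» on their certified `SU(3,3)`-monodromy families (RING2-MAP AW1.147 / AW2.88).

EDGE LABELS: all rows K[Verdier] with the habitat node `(W_E)₃` as hypothesis; `HC_CM` absent. No `def`, no `sorry`; axioms standard.

References: vanGeemen1994HodgeAV (Thm. 4.3, 5.12); Andre1996Motifs (Lemme 6.3.3 p. 33, Remarque 2); Verdier1976 (Cor. (5.1));
CharlesSchnell2014Notes (Prop. 11.3.11, Cor. 11.3.6); MoonenZarhin1999LowDim; Schoen1998HodgeWeilAddendum.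
-/

noncomputable section

set_option linter.dupNamespace false

namespace Summit.HodgeConjecture.HodgeConjecture.Ring2.AbelianAll

open CategoryTheory AlgebraicGeometry
open Literature.AlgebraicGeometry Literature.AlgebraicGeometry.Motives
open Literature.AlgebraicGeometry.HodgeTheory
open Summit.HodgeConjecture.HodgeConjecture
open Summit.HodgeConjecture.HodgeConjecture.Theses
open Summit.HodgeConjecture.HodgeConjecture.Ring2.Hypotheses (cmPowerLocus)
open Summit.HodgeConjecture.HodgeConjecture.WeilTypeLadder (NonsplitSixfolds nonsplitSixfolds_of_weilSixfolds)

/-- **W₆ ⟸ (W_E)₃ ∧ [UNCOUNTABLY MANY 3-GOOD MEMBERS on every `E`-power-pointed compact pencil of abelian sixfolds], granted Verdier.**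
"3-good" at `s`: every global class of degree 6 with rational `(3,3)` fibre restrictions (every invariant Hodge class of degree 6) is
algebraic on `X_s`. Part XXXI-d gives the lift `(L)_t(3)` at every point of such a pencil; part XXVIII-e turns the lift at the `E`-power
points into `WeilSixfolds`. No `HC_CM`. [cite: vanGeemen1994HodgeAV, Thm. 4.3 and 5.12] [cite: Verdier1976, Cor. (5.1)]
[cite: Andre1996Motifs, Lemme 6.3.3 (p. 33) and Remarque 2] -/
theorem weilSixfolds_of_cmPowerWeilPencilsAt_of_not_countable_good_of_verdier (hGT : Verdier1976_genericLocalTriviality)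
    (hW : CMPowerAnchoredCompactWeilPencilsAt 3)
    (h : ∀ ⦃𝒳 S : SchemeOver ℂ⦄ (f : 𝒳 ⟶ S) (hf : IsCompactAbelianPencil f 6), (cmPowerLocus f 6).Nonempty →
      ¬ {s : ComplexPoints S | ∀ W : complexBetti 𝒳 (2 * 3),
          (∀ s' : ComplexPoints S, IsRationalClass (complexBetti.map (fiberι f s') (2 * 3) W) ∧
            IsOfHodgeType 6 (fiberOver f s') (2 * 3) 3 3 (complexBetti.map (fiberι f s') (2 * 3) W)) →
          complexBetti.map (fiberι f s) (2 * 3) W ∈ algebraicClasses (fiberOver f s) 3}.Countable) :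
    Theses.SevenfoldWeilCensus.WeilSixfolds :=
  weilSixfolds_of_cmPowerWeilPencilsAt_of_lift_three hW fun _ _ f hf t ht ↦
    comap_le_sup_of_not_countable_good_of_verdier hGT hf 3 (h f hf ⟨t, ht⟩) t

/-- The NON-SPLIT twin. [cite: Andre1996Motifs, Lemme 6.3.3 (p. 33)] [cite: Verdier1976, Cor. (5.1)] -/
theorem nonsplitSixfolds_of_cmPowerWeilPencilsAt_of_not_countable_good_of_verdier (hGT : Verdier1976_genericLocalTriviality)
    (hW : CMPowerAnchoredCompactWeilPencilsAt 3)
    (h : ∀ ⦃𝒳 S : SchemeOver ℂ⦄ (f : 𝒳 ⟶ S) (hf : IsCompactAbelianPencil f 6), (cmPowerLocus f 6).Nonempty →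
      ¬ {s : ComplexPoints S | ∀ W : complexBetti 𝒳 (2 * 3),
          (∀ s' : ComplexPoints S, IsRationalClass (complexBetti.map (fiberι f s') (2 * 3) W) ∧
            IsOfHodgeType 6 (fiberOver f s') (2 * 3) 3 3 (complexBetti.map (fiberι f s') (2 * 3) W)) →
          complexBetti.map (fiberι f s) (2 * 3) W ∈ algebraicClasses (fiberOver f s) 3}.Countable) :
    NonsplitSixfolds :=
  nonsplitSixfolds_of_weilSixfolds (weilSixfolds_of_cmPowerWeilPencilsAt_of_not_countable_good_of_verdier hGT hW h)

/-- **W₆ ⟸ (W_E)₃ ∧ [the members over UNCOUNTABLY many points of every `E`-power-pointed compact pencil of abelian sixfolds satisfy the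
Hodge conjecture in degree 6], granted Verdier** (part XXXI-b's per-pencil rung + part XXVIII-e). No `HC_CM`.
[cite: vanGeemen1994HodgeAV, Thm. 4.3 and 5.12] [cite: Verdier1976, Cor. (5.1)] [cite: CharlesSchnell2014Notes, Cor. 11.3.6] -/
theorem weilSixfolds_of_cmPowerWeilPencilsAt_of_not_countable_hodge_of_verdier (hGT : Verdier1976_genericLocalTriviality)
    (hW : CMPowerAnchoredCompactWeilPencilsAt 3)
    (h : ∀ ⦃𝒳 S : SchemeOver ℂ⦄ (f : 𝒳 ⟶ S) (hf : IsCompactAbelianPencil f 6), (cmPowerLocus f 6).Nonempty →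
      ¬ {s : ComplexPoints S | ∀ c : complexBetti (fiberOver f s) (2 * 3), IsRationalClass c →
          IsOfHodgeType 6 (fiberOver f s) (2 * 3) 3 3 c → c ∈ algebraicClasses (fiberOver f s) 3}.Countable) :
    Theses.SevenfoldWeilCensus.WeilSixfolds :=
  weilSixfolds_of_cmPowerWeilPencilsAt_of_lift_three hW fun _ _ f hf t ht ↦
    comap_le_sup_of_not_countable_hodge_of_verdier hGT hf 3 (h f hf ⟨t, ht⟩) t

/-- The NON-SPLIT twin. [cite: Andre1996Motifs, Lemme 6.3.3 (p. 33)] [cite: Verdier1976, Cor. (5.1)] -/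
theorem nonsplitSixfolds_of_cmPowerWeilPencilsAt_of_not_countable_hodge_of_verdier (hGT : Verdier1976_genericLocalTriviality)
    (hW : CMPowerAnchoredCompactWeilPencilsAt 3)
    (h : ∀ ⦃𝒳 S : SchemeOver ℂ⦄ (f : 𝒳 ⟶ S) (hf : IsCompactAbelianPencil f 6), (cmPowerLocus f 6).Nonempty →
      ¬ {s : ComplexPoints S | ∀ c : complexBetti (fiberOver f s) (2 * 3), IsRationalClass c →
          IsOfHodgeType 6 (fiberOver f s) (2 * 3) 3 3 c → c ∈ algebraicClasses (fiberOver f s) 3}.Countable) :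
    NonsplitSixfolds :=
  nonsplitSixfolds_of_weilSixfolds (weilSixfolds_of_cmPowerWeilPencilsAt_of_not_countable_hodge_of_verdier hGT hW h)

/-- **W₆ ⟸ (W_E)₃ ∧ [`HodgeConjectureFor 6` at the members over uncountably many points of every `E`-power-pointed compact pencil of
abelian sixfolds], granted Verdier.** A density reduction: the Hodge conjecture for a thick set of members of EVERY `E`-power-pointed
compact pencil of abelian sixfolds — Weil-type or not, not only the habitat pencils (F-ab-131 (a)) — gives it for ALL Weil-type abelian
sixfolds. No `HC_CM`. [cite: vanGeemen1994HodgeAV, Thm. 4.3 and 5.12] [cite: Verdier1976, Cor. (5.1)] -/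
theorem weilSixfolds_of_cmPowerWeilPencilsAt_of_not_countable_hodgeConjectureFor_of_verdier
    (hGT : Verdier1976_genericLocalTriviality) (hW : CMPowerAnchoredCompactWeilPencilsAt 3)
    (h : ∀ ⦃𝒳 S : SchemeOver ℂ⦄ (f : 𝒳 ⟶ S), IsCompactAbelianPencil f 6 → (cmPowerLocus f 6).Nonempty →
      ¬ {s : ComplexPoints S | HodgeConjectureFor 6 (fiberOver f s)}.Countable) :
    Theses.SevenfoldWeilCensus.WeilSixfolds :=
  weilSixfolds_of_cmPowerWeilPencilsAt_of_not_countable_hodge_of_verdier hGT hW fun _ _ f hf hne hc ↦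
    h f hf hne (hc.mono fun _ hs c hcQ hcH ↦ hs.2 3 c hcQ hcH)

/-- The NON-SPLIT twin. [cite: Andre1996Motifs, Lemme 6.3.3 (p. 33)] [cite: Verdier1976, Cor. (5.1)] -/
theorem nonsplitSixfolds_of_cmPowerWeilPencilsAt_of_not_countable_hodgeConjectureFor_of_verdier
    (hGT : Verdier1976_genericLocalTriviality) (hW : CMPowerAnchoredCompactWeilPencilsAt 3)
    (h : ∀ ⦃𝒳 S : SchemeOver ℂ⦄ (f : 𝒳 ⟶ S), IsCompactAbelianPencil f 6 → (cmPowerLocus f 6).Nonempty →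
      ¬ {s : ComplexPoints S | HodgeConjectureFor 6 (fiberOver f s)}.Countable) :
    NonsplitSixfolds :=
  nonsplitSixfolds_of_weilSixfolds
    (weilSixfolds_of_cmPowerWeilPencilsAt_of_not_countable_hodgeConjectureFor_of_verdier hGT hW h)

end Summit.HodgeConjecture.HodgeConjecture.Ring2.AbelianAll

end
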